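import Summits.QuantumFields.YangMills.Theorems.AllWindowsColdBoxBoxHighLineK3PrimeRowE1Wilson
import Summits.QuantumFields.YangMills.Theorems.AllWindowsColdBoxBoxHighLineK3PrimeRowSumRows
import Summits.QuantumFields.YangMills.Theorems.AllWindowsColdBoxBoxHighLineRestrictionSetCum3Slots

/-!
# U5 K3′ — row E1-Wilson (the polynomial quartic Wilson vertex `−W₄^{poly}`) in the per-row `hKk` currency of the hK3 ROW SUM, BY NAME
# (planner ym-idea-2 g19 01:44:58Z / 01:52:29Z: `hE1r = E1-Wilson ⊕ E1-Φ`; fcl-p3 g27's ✓`K3RowSum.tiltCum3_cutSet_size_of_rows (Vr) … (hE1r) …`)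

Width seat `ym-line-sfw-p2-w3` (g42), cell ym-idea-1.  Companion of fcl-p3 g27's ✓`…K3PrimeRowSumRows` (`K3RowSum.rowBound_of_quadSize`, E1-ghost, E1-Haar, E2):

* `K3RowSum.rowBound_of_quadSize'` — the `β`-DEPENDENT twin of ✓`rowBound_of_quadSize`: a landed row
  `|κ₃^{μ_D}(L_x, L_y; V β H)| ≤ β⁻¹^3·C′·(1+log H)⁵·(1 + √τ·H⁴)` on every measurable `D ⊆ smallField H s` with `E₀[1−1_D] ≤ τ ≤ 1/2` becomes, with `τ := β⁻¹`
  (`q := 1`), `K β H := C′·(1+log H)⁵·(1 + √(β⁻¹)·H⁴)/β³` with the budget `β²H⁸·K → 0` (rows `H⁸L⁵β⁻¹` [`8θ − 1 < 0`] and `H¹²L⁵β^{−3/2}` [`12θ − 3/2 < 0`], strict for every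
  `θ < 1/10`; same proof);
* ★★ `K3RowSum.rowBound_E1_wilson` — for the generic bounded pair tensor `Q` (`|Q_{ijkl}| ≤ B`; instance of record: ✓`WilsonTaylor.exists_quarticTensor_quarticWilson`, `B = 1/2`),
  the row with tilt slot `V β H a := −(β·Σ_{z touching} Σ_{ijkl} Q_{ijkl}(v^z_i·v^z_j)(v^z_k·v^z_l))` (= `−W₄^{poly}`, the Wilson part of `Vr`) in the `hKk` shape VERBATIM, from this seat's
  ✓`GaussRestrict.abs_tiltCum3_muSet_linCurvSq_linCurvSq_quarticPairVertex_le` (p756224) and the sign rule ✓`GaussRestrict.tiltCum3_zero_const_mul_third` (`c = −1`).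
`hE1r` of the ROW SUM (`Vr := −W₄^{poly} − β·phiQuartic`) is then `rowBound_E1_wilson ⊕` w2 g33's E1-Φ row via fcl-p3's ✓`abs_tiltCum3_muSet_linCurvSq_add_third_le`.

No definitions; tree only; standard axioms.  HONEST LABEL: helper-grade U5 prep (one half of one row of hK3 by name; hK3 itself is NOT proved); U5, ⟨stmt-QuantumFields-24336⟩, ⟨24004⟩ and
this seat's crux ⟨22884⟩ remain OPEN; route AllWindowsColdBox is DRAFT; no crux, rung or summit is proved; **the Yang–Mills mass gap is NOT proved by this file; no summit is
proved by a line.**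
-/

set_option autoImplicit false

noncomputable section

open MeasureTheory

open Literature.Probability.LatticeModels (Site)
open Literature.MathematicalPhysics.QuantumLattice (ZdPlaquette plaquettesTouching)
open Literature.MathematicalPhysics.QuantumFieldTheory.AxialGauge (boxEdges)
open Summit.QuantumFields.YangMills.Theorems.WeakCouplingRates (plaq12At)

namespace Summit.QuantumFields.YangMills.Theorems.AllWindowsColdBoxBoxHighLine

namespace K3RowSum

open AssemblyBudget ErrorBudget

/-- The `β`-dependent twin of ✓`rowBound_of_quadSize`: the per-row `hKk` currency of an exact row with the size `β⁻¹^3·C′·(1+log H)⁵·(1 + √τ·H⁴)`, for a tilt slot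
`V β H` that may depend on `β` (`q := 1`; budgets `H⁸L⁵β⁻¹` [`8θ − 1 < 0`], `H¹²L⁵β^{−3/2}` [`12θ − 3/2 < 0`]). -/
theorem rowBound_of_quadSize' {θ : ℝ} (hθ : 0 < θ) (hθ' : θ < 1 / 10) {C' : ℝ} {V : ℝ → (H : ℕ) → (LandauFree H → E3) → ℝ}
    (hV : ∀ H : ℕ, 1 ≤ H → ∀ β : ℝ, 0 < β → ∀ x y : Site 4, ∀ μ₁ ν₁ μ₂ ν₂ : Fin 4, ∀ s : ℝ, 0 ≤ s → ∀ D : Set (LandauFree H → E3), MeasurableSet D →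
      D ⊆ smallField H s → ∀ τ : ℝ, gaussAvg β H (fun a => 1 - D.indicator (fun _ => (1 : ℝ)) a) ≤ τ → τ ≤ 1 / 2 →
      |Tilt.tiltCum3 ((((volume : Measure (LandauFree H → E3)).restrict D).withDensity fun a => ENNReal.ofReal (gaussWeight β H a)))
          (V β H) 0 (linCurvSq H (x, μ₁, ν₁)) (linCurvSq H (y, μ₂, ν₂))| ≤ β⁻¹ ^ 3 * (C' * (1 + Real.log H) ^ 5 * (1 + Real.sqrt τ * (H : ℝ) ^ 4))) :
    ∃ q : ℝ, ∃ K : ℝ → ℕ → ℝ,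
      (∃ β₀ : ℝ, 1 ≤ β₀ ∧ ∀ β : ℝ, β₀ ≤ β → ∀ H : ℕ, 1 ≤ H → β ^ θ ≤ (H : ℝ) → (H : ℝ) ≤ β ^ θ + 1 →
        ∀ D : Set (LandauFree H → E3), MeasurableSet D → D ⊆ smallField H (β ^ ((1 / 8 - θ / 4) - 1 / 2)) → (∀ a, -a ∈ D ↔ a ∈ D) →
        gaussAvg β H (fun a => 1 - D.indicator (fun _ => (1 : ℝ)) a) ≤ β ^ (-q) →
        gaussAvg β H (fun a => 1 - D.indicator (fun _ => (1 : ℝ)) a) ≤ 1 / 2 → (∀ a ∈ D, |tiltU β H a| ≤ 2) → ∀ x y : Site 4,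
        |Tilt.tiltCum3 (((volume : Measure (LandauFree H → E3)).restrict D).withDensity fun a => ENNReal.ofReal (gaussWeight β H a))
            (V β H) 0 (linCurvSq H (plaq12At x)) (linCurvSq H (plaq12At y))| ≤ K β H) ∧
      (∀ ε : ℝ, 0 < ε → ∃ β₀ : ℝ, 1 ≤ β₀ ∧ ∀ β : ℝ, β₀ ≤ β → ∀ H : ℕ, 1 ≤ H → (H : ℝ) ≤ β ^ θ + 1 → β ^ 2 * (H : ℝ) ^ 8 * K β H ≤ ε) := by
  refine ⟨1, fun β H => C' * (1 + Real.log H) ^ 5 * (1 + Real.sqrt (β ^ (-(1 : ℝ))) * (H : ℝ) ^ 4) / β ^ 3, ⟨2, by norm_num, ?_⟩, ?_⟩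
  · intro β hβ H hH _ _ D hDm hDs _ hco _ _ x y
    have hβ0 : 0 < β := by linarith
    have hτ2 : β ^ (-(1 : ℝ)) ≤ 1 / 2 := by
      rw [Real.rpow_neg_one]
      have h := inv_anti₀ (by norm_num : (0 : ℝ) < 2) hβ
      norm_num at h ⊢
      exact h
    have h1 := hV H hH β hβ0 x y 1 2 1 2 _ (Real.rpow_nonneg hβ0.le _) D hDm hDs (β ^ (-(1 : ℝ))) hco hτ2
    have e : β⁻¹ ^ 3 * (C' * (1 + Real.log H) ^ 5 * (1 + Real.sqrt (β ^ (-(1 : ℝ))) * (H : ℝ) ^ 4)) =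
        C' * (1 + Real.log H) ^ 5 * (1 + Real.sqrt (β ^ (-(1 : ℝ))) * (H : ℝ) ^ 4) / β ^ 3 := by
      rw [inv_pow, div_eq_mul_inv, mul_comm]
    rw [e] at h1
    exact h1
  · intro ε hε
    have hε' : 0 < ε / 2 := half_pos hε
    obtain h₁ := budget_monomial (a := -1) (k := 8) (j := 0) (κ₃ := 0) hθ.le (by push_cast; linarith) hε' C' 5
    obtain h₂ := budget_monomial (a := -(3 / 2)) (k := 12) (j := 0) (κ₃ := 0) hθ.le (by push_cast; linarith) hε' C' 5
    obtain ⟨β₀, hβ₀, hall⟩ := exists_forall_and h₁ h₂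
    refine ⟨β₀, hβ₀, fun β hβ H hH hHu => ?_⟩
    obtain ⟨e₁, e₂⟩ := hall β hβ H
    replace e₁ := e₁ hH hHu
    replace e₂ := e₂ hH hHu
    simp only [pow_zero, mul_one] at e₁ e₂
    have hβ0 : 0 < β := by linarith
    have hsq : Real.sqrt (β ^ (-(1 : ℝ))) = β ^ (-(1 / 2 : ℝ)) := by
      rw [Real.sqrt_eq_rpow, ← Real.rpow_mul hβ0.le]; norm_num
    have hb3 : (β : ℝ) ^ 3 = β ^ (3 : ℝ) := by rw [← Real.rpow_natCast]; norm_num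
    have hb2 : (β : ℝ) ^ 2 = β ^ (2 : ℝ) := by rw [← Real.rpow_natCast]; norm_num
    have hm1 : β ^ (-1 : ℝ) = β ^ (2 : ℝ) * (β ^ (3 : ℝ))⁻¹ := by
      rw [← Real.rpow_neg hβ0.le, ← Real.rpow_add hβ0]; norm_num
    have hm2 : β ^ (-(3 / 2) : ℝ) = β ^ (2 : ℝ) * (β ^ (-(1 / 2 : ℝ)) * (β ^ (3 : ℝ))⁻¹) := by
      rw [← Real.rpow_neg hβ0.le, ← Real.rpow_add hβ0, ← Real.rpow_add hβ0]; norm_num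
    have hid : β ^ 2 * (H : ℝ) ^ 8 * (C' * (1 + Real.log H) ^ 5 * (1 + Real.sqrt (β ^ (-(1 : ℝ))) * (H : ℝ) ^ 4) / β ^ 3) =
        C' * (H : ℝ) ^ 8 * (1 + Real.log H) ^ 5 * β ^ (-1 : ℝ) +
          C' * (H : ℝ) ^ 12 * (1 + Real.log H) ^ 5 * β ^ (-(3 / 2) : ℝ) := by
      rw [hsq, hb3, hb2, div_eq_mul_inv, hm1, hm2]; ring
    rw [hid]
    linarith

/-- ★★ **Row E1-Wilson (the polynomial quartic Wilson vertex, tilt slot `−W₄^{poly}`) in the per-row `hKk` currency, BY NAME** from this seat's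
✓`GaussRestrict.abs_tiltCum3_muSet_linCurvSq_linCurvSq_quarticPairVertex_le` (p756224): for every bounded pair tensor `|Q_{ijkl}| ≤ B`, `q := 1`,
`K β H := C·B·(1+log H)⁵·(1 + √(β⁻¹)·H⁴)/β³`; budgets `H⁸L⁵β⁻¹` [`8θ − 1 < 0`] and `H¹²L⁵β^{−3/2}` [`12θ − 3/2 < 0`] at every `κ₃` — strict for every `θ < 1/10`. -/
theorem rowBound_E1_wilson : ∀ θ : ℝ, 0 < θ → θ < 1 / 10 → ∀ B : ℝ, ∀ Q : Fin 4 → Fin 4 → Fin 4 → Fin 4 → ℝ, (∀ i j k l, |Q i j k l| ≤ B) →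
    ∃ q : ℝ, ∃ K : ℝ → ℕ → ℝ,
      (∃ β₀ : ℝ, 1 ≤ β₀ ∧ ∀ β : ℝ, β₀ ≤ β → ∀ H : ℕ, 1 ≤ H → β ^ θ ≤ (H : ℝ) → (H : ℝ) ≤ β ^ θ + 1 →
        ∀ D : Set (LandauFree H → E3), MeasurableSet D → D ⊆ smallField H (β ^ ((1 / 8 - θ / 4) - 1 / 2)) → (∀ a, -a ∈ D ↔ a ∈ D) →
        gaussAvg β H (fun a => 1 - D.indicator (fun _ => (1 : ℝ)) a) ≤ β ^ (-q) →
        gaussAvg β H (fun a => 1 - D.indicator (fun _ => (1 : ℝ)) a) ≤ 1 / 2 → (∀ a ∈ D, |tiltU β H a| ≤ 2) → ∀ x y : Site 4,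
        |Tilt.tiltCum3 (((volume : Measure (LandauFree H → E3)).restrict D).withDensity fun a => ENNReal.ofReal (gaussWeight β H a))
            (fun a => -(β * ∑ z ∈ plaquettesTouching (boxEdges 4 (2 * H + 1)), ∑ i : Fin 4, ∑ j : Fin 4, ∑ k : Fin 4, ∑ l : Fin 4, Q i j k l *
              ((WithLp.ofLp (plaqVar H z.1 z.2.1.1 z.2.1.2 a i) ⬝ᵥ WithLp.ofLp (plaqVar H z.1 z.2.1.1 z.2.1.2 a j)) *
                (WithLp.ofLp (plaqVar H z.1 z.2.1.1 z.2.1.2 a k) ⬝ᵥ WithLp.ofLp (plaqVar H z.1 z.2.1.1 z.2.1.2 a l))))) 0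
            (linCurvSq H (plaq12At x)) (linCurvSq H (plaq12At y))| ≤ K β H) ∧
      (∀ ε : ℝ, 0 < ε → ∃ β₀ : ℝ, 1 ≤ β₀ ∧ ∀ β : ℝ, β₀ ≤ β → ∀ H : ℕ, 1 ≤ H → (H : ℝ) ≤ β ^ θ + 1 → β ^ 2 * (H : ℝ) ^ 8 * K β H ≤ ε) := by
  intro θ hθ hθ' B Q hQ
  obtain ⟨C, -, h⟩ := GaussRestrict.abs_tiltCum3_muSet_linCurvSq_linCurvSq_quarticPairVertex_le
  refine rowBound_of_quadSize' hθ hθ' (C' := C * B)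
    (V := fun β H a => -(β * ∑ z ∈ plaquettesTouching (boxEdges 4 (2 * H + 1)), ∑ i : Fin 4, ∑ j : Fin 4, ∑ k : Fin 4, ∑ l : Fin 4, Q i j k l *
      ((WithLp.ofLp (plaqVar H z.1 z.2.1.1 z.2.1.2 a i) ⬝ᵥ WithLp.ofLp (plaqVar H z.1 z.2.1.1 z.2.1.2 a j)) *
        (WithLp.ofLp (plaqVar H z.1 z.2.1.1 z.2.1.2 a k) ⬝ᵥ WithLp.ofLp (plaqVar H z.1 z.2.1.1 z.2.1.2 a l))))) ?_
  intro H hH β hβ x y μ₁ ν₁ μ₂ ν₂ s hs D hDm hDs τ hτ hτ2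
  have h1 := h H hH β hβ B Q hQ x y μ₁ ν₁ μ₂ ν₂ s hs D hDm hDs τ hτ hτ2
  have hneg : (fun a : LandauFree H → E3 => -(β * ∑ z ∈ plaquettesTouching (boxEdges 4 (2 * H + 1)), ∑ i : Fin 4, ∑ j : Fin 4, ∑ k : Fin 4, ∑ l : Fin 4,
      Q i j k l * ((WithLp.ofLp (plaqVar H z.1 z.2.1.1 z.2.1.2 a i) ⬝ᵥ WithLp.ofLp (plaqVar H z.1 z.2.1.1 z.2.1.2 a j)) *
        (WithLp.ofLp (plaqVar H z.1 z.2.1.1 z.2.1.2 a k) ⬝ᵥ WithLp.ofLp (plaqVar H z.1 z.2.1.1 z.2.1.2 a l))))) =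
      fun a => (-1 : ℝ) * (β * ∑ z ∈ plaquettesTouching (boxEdges 4 (2 * H + 1)), ∑ i : Fin 4, ∑ j : Fin 4, ∑ k : Fin 4, ∑ l : Fin 4,
        Q i j k l * ((WithLp.ofLp (plaqVar H z.1 z.2.1.1 z.2.1.2 a i) ⬝ᵥ WithLp.ofLp (plaqVar H z.1 z.2.1.1 z.2.1.2 a j)) *
          (WithLp.ofLp (plaqVar H z.1 z.2.1.1 z.2.1.2 a k) ⬝ᵥ WithLp.ofLp (plaqVar H z.1 z.2.1.1 z.2.1.2 a l)))) := by
    funext a; ring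
  rw [hneg, GaussRestrict.tiltCum3_zero_const_mul_third, abs_mul, abs_neg, abs_one, one_mul]
  exact h1

end K3RowSum

end Summit.QuantumFields.YangMills.Theorems.AllWindowsColdBoxBoxHighLine

end
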